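import Summits.CriticalPhenomena.SAWScalingLimit.Theorems.SAWLoopFugacityFlowSimpleSubseqLimitsPSStubDecomposition
import Summits.CriticalPhenomena.SAWScalingLimit.Theorems.SimpleSubseqLimits.Negative.SimpleSubseqLimitsThickeningNecessity
import Summits.CriticalPhenomena.SAWScalingLimit.Theorems.SAWLoopFugacityFlowSimpleSubseqLimitsPSShadowDecayPinned
import HarnessLib

/-!
# Line `past-shadowing-costs-halves` (crux `SAWLoopFugacityFlow.SimpleSubseqLimits`, stmt-CriticalPhenomena-4982):
the input `RootReturn` is PINNED — implied by the summit conjecture, necessary for the crux given `EventualTight`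

Support file (lead prover c1). `RootReturn` (reshaped skeleton `Lines/past_shadowing_costs_halves.lean`; the
verbatim copy `Decomposition.RootReturn` of the landed decomposition file is used) is the line's root-side lattice
input: for every `(D; a_δ, b_δ)`, `r`, `θ` some `ρ₀ < r` with `P_δ[a vertex at distance ≥ r from a, a LATER
vertex at distance ≤ ρ₀] ≤ θ` for small `δ`. This file shows it is not over-strong and wastes nothing:

* `rootReturn_of_sawScalingLimit : SAWScalingLimit → RootReturn`,
* `rootReturn_of_crux : EventualTight → SimpleSubseqLimits → RootReturn`,

and `slitShadowDecay_of_shadowDecay : ShadowDecay → SlitShadowDecay` (the G-type input is a sub-event bound of the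
sibling line's `ShadowDecay`, itself pinned both ways in `…PSShadowDecayPinned.lean`; whence
`slitShadowDecay_of_sawScalingLimit`, `slitShadowDecay_of_crux`, and the joint pins `inputs_of_sawScalingLimit :
SAWScalingLimit → RootReturn ∧ SlitShadowDecay`, `inputs_of_crux : EventualTight → SimpleSubseqLimits →
RootReturn ∧ SlitShadowDecay`), the first two from the landed necessity principle for closed antitone thickenings
(`Negative.exists_limsup_law_le_of_sawScalingLimit` / `…_of_crux`, p84995) applied to the closed class events
`F n = mk '' {γ | ∃ s ≤ t, r ≤ |γ s − a|, |γ t − a| ≤ r/(n+2)}`, whose intersection misses every simple chord from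
`a` (compactness of `I × I`: a limit pair `s* ≤ t*` with `γ t* = a = γ 0` forces `t* = 0 = s*`, but `|γ s* − a| ≥ r`).
-/

noncomputable section

open MeasureTheory Filter Topology Set Metric
open scoped ENNReal NNReal unitInterval

namespace Summit.CriticalPhenomena.SAWScalingLimit.Theorems.SimpleSubseqLimits.PastShadowing.RootReturnPinned

open Literature.Probability.RandomPlanarGeometry Literature.Probability.RandomPlanarGeometry.SAW
open Literature.Probability.LatticeModels
open Summit.CriticalPhenomena.SAWScalingLimit.Theses.SAWLoopFugacityFlow (SimpleSubseqLimits EventualTight)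
open Summit.CriticalPhenomena.SAWScalingLimit.Theorems.SimpleSubseqLimits.Negative
  (Carrier exists_limsup_law_le_of_sawScalingLimit exists_limsup_law_le_of_crux)
open Summit.CriticalPhenomena.SAWScalingLimit.Theorems.SimpleSubseqLimits.PastShadowing.Clock
open Summit.CriticalPhenomena.SAWScalingLimit.Theorems.SimpleSubseqLimits.PastShadowing.Core
open Literature.Probability.RandomPlanarGeometry (dyadicTime dyadicTime_mono)
open Summit.CriticalPhenomena.SAWScalingLimit.Theorems.SimpleSubseqLimits.PastShadowing.Decomposition

/-! ## The return events on curves and classes -/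

/-- Curves having a point at distance `≥ r` from `c` followed (in time) by a point at distance `≤ ρ`
from `c`. Reparametrisation invariant. [folklore] -/
def returnCurves (c : ℂ) (r ρ : ℝ) : Set (Curve ℂ) :=
  {γ | ∃ s t : I, s ≤ t ∧ r ≤ dist (γ s) c ∧ dist (γ t) c ≤ ρ}

/-- **Compactness core**: approximate ordered witnesses for all slacks give exact ones. [folklore] -/
theorem mem_returnCurves_of_forall {γ : Curve ℂ} {c : ℂ} {r ρ : ℝ}
    (h : ∀ κ : ℝ, 0 < κ → ∃ s t : I, s ≤ t ∧ r - κ ≤ dist (γ s) c ∧ dist (γ t) c ≤ ρ + κ) :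
    γ ∈ returnCurves c r ρ := by
  choose s t hst hs ht using fun n : ℕ => h (1 / ((n : ℝ) + 1)) (by positivity)
  obtain ⟨p, -, φ, hφ, hlim⟩ :=
    (isCompact_univ (X := I × I)).tendsto_subseq (x := fun n => (s n, t n)) (fun _ => mem_univ _)
  have h1 : Tendsto (fun n => s (φ n)) atTop (𝓝 p.1) := (continuous_fst.tendsto p).comp hlim
  have h2 : Tendsto (fun n => t (φ n)) atTop (𝓝 p.2) := (continuous_snd.tendsto p).comp hlim
  have hκ : Tendsto (fun n : ℕ => 1 / ((φ n : ℝ) + 1)) atTop (𝓝 0) :=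
    tendsto_one_div_add_atTop_nhds_zero_nat.comp hφ.tendsto_atTop
  refine ⟨p.1, p.2, ?_, ?_, ?_⟩
  · exact le_of_tendsto_of_tendsto h1 h2 (Eventually.of_forall fun n => hst (φ n))
  · have hc : Tendsto (fun n => dist (γ (s (φ n))) c) atTop (𝓝 (dist (γ p.1) c)) :=
      ((γ.continuous.dist continuous_const).tendsto _).comp h1
    have hl : Tendsto (fun n : ℕ => r - 1 / ((φ n : ℝ) + 1)) atTop (𝓝 (r - 0)) :=
      tendsto_const_nhds.sub hκ
    rw [sub_zero] at hl
    exact le_of_tendsto_of_tendsto hl hc (Eventually.of_forall fun n => hs (φ n))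
  · have hc : Tendsto (fun n => dist (γ (t (φ n))) c) atTop (𝓝 (dist (γ p.2) c)) :=
      ((γ.continuous.dist continuous_const).tendsto _).comp h2
    have hl : Tendsto (fun n : ℕ => ρ + 1 / ((φ n : ℝ) + 1)) atTop (𝓝 (ρ + 0)) :=
      tendsto_const_nhds.add hκ
    rw [add_zero] at hl
    exact le_of_tendsto_of_tendsto hc hl (Eventually.of_forall fun n => ht (φ n))

/-- Transport of approximate witnesses along a reparametrisation at sup-distance `< κ`. [folklore] -/
theorem exists_witness_of_dist_lt {γ γ' : Curve ℂ} {c : ℂ} {r ρ κ : ℝ} (hd : dist γ γ' < κ)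
    (h : γ' ∈ returnCurves c r ρ) :
    ∃ s t : I, s ≤ t ∧ r - κ ≤ dist (γ s) c ∧ dist (γ t) c ≤ ρ + κ := by
  obtain ⟨φ, hφ⟩ := Curve.exists_dist_reparam_lt hd
  have hcl : ∀ u, dist (γ u) (γ' (φ u)) < κ := fun u => by
    have h := ContinuousMap.dist_apply_le_dist (f := γ.toContinuousMap)
      (g := (γ'.reparam φ).toContinuousMap) (x := u)
    simp only [Curve.coe_toContinuousMap, Curve.reparam_apply] at h
    exact h.trans_lt hφ
  obtain ⟨s, t, hst, hs, ht⟩ := h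
  refine ⟨φ.symm s, φ.symm t, φ.symm.monotone hst, ?_, ?_⟩
  · have h1 := hcl (φ.symm s)
    rw [OrderIso.apply_symm_apply] at h1
    linarith [dist_triangle (γ' s) (γ (φ.symm s)) c, dist_comm (γ (φ.symm s)) (γ' s)]
  · have h1 := hcl (φ.symm t)
    rw [OrderIso.apply_symm_apply] at h1
    linarith [dist_triangle (γ (φ.symm t)) (γ' t) c]

/-- The return event on curves is closed for the reparametrisation pseudo-distance. [folklore] -/
theorem isClosed_returnCurves (c : ℂ) (r ρ : ℝ) : IsClosed (returnCurves c r ρ) := by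
  refine isClosed_of_closure_subset fun γ hγ => mem_returnCurves_of_forall fun κ hκ => ?_
  obtain ⟨γ', hγ', hd⟩ := Metric.mem_closure_iff.1 hγ κ hκ
  exact exists_witness_of_dist_lt hd hγ'

/-- The class-level return event `mk '' returnCurves` is closed (`SeparationQuotient.mk` is a closed
map). [folklore] -/
theorem isClosed_image_returnCurves (c : ℂ) (r ρ : ℝ) :
    IsClosed (CurveClass.mk '' returnCurves c r ρ) :=
  SeparationQuotient.isClosedMap_mk _ (isClosed_returnCurves c r ρ)

/-- The return events are monotone in the inner radius. [folklore] -/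
theorem returnCurves_mono (c : ℂ) (r : ℝ) {ρ ρ' : ℝ} (h : ρ ≤ ρ') :
    returnCurves c r ρ ⊆ returnCurves c r ρ' :=
  fun _ ⟨s, t, hst, hs, ht⟩ => ⟨s, t, hst, hs, ht.trans h⟩

/-- **No simple chord from `a` lies in all the return events** (`ρ = r/(n+2) → 0`): a representative
in every event gives, for the injective representative `γ₀` with `γ₀ 0 = a`, witnesses with every slack,
hence (compactness) `s* ≤ t*` with `|γ₀ s* − a| ≥ r > 0` and `γ₀ t* = a = γ₀ 0`, so `t* = 0 = s*`:
contradiction. [folklore] -/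
theorem not_carrier_of_forall_mem (D : DobrushinDomain) {r : ℝ} (hr : 0 < r) (x : CurveClass ℂ)
    (hx : ∀ n : ℕ, x ∈ CurveClass.mk '' returnCurves (D.pt 0) r (r / ((n : ℝ) + 2))) :
    ¬ Carrier D x := by
  rintro ⟨hsimple, hsrc, -, -, -⟩
  obtain ⟨γ₀, hγ₀, rfl⟩ := hsimple
  have h0 : γ₀ 0 = D.pt 0 := by
    rw [CurveClass.source_mk, Curve.source_def] at hsrc; exact hsrc
  have hmem : γ₀ ∈ returnCurves (D.pt 0) r 0 := by
    refine mem_returnCurves_of_forall fun κ hκ => ?_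
    obtain ⟨n, hn⟩ := exists_nat_gt (2 * r / κ)
    obtain ⟨γ', hγ', heq⟩ := hx n
    have hd : dist γ₀ γ' < κ / 2 := by
      rw [dist_comm, CurveClass.mk_eq_mk_iff_dist_eq_zero.1 heq]; positivity
    obtain ⟨s, t, hst, hs, ht⟩ := exists_witness_of_dist_lt hd hγ'
    refine ⟨s, t, hst, by linarith, ?_⟩
    have hρ : r / ((n : ℝ) + 2) ≤ κ / 2 := by
      rw [div_le_iff₀ (by positivity)]
      rw [div_lt_iff₀ hκ] at hn
      nlinarith
    linarith
  obtain ⟨s, t, hst, hs, ht⟩ := hmem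
  have ht0 : γ₀ t = γ₀ 0 := by
    rw [h0]; exact dist_le_zero.1 ht
  have ht' : t = 0 := hγ₀ ht0
  have hs' : s = 0 := le_antisymm (ht' ▸ hst) bot_le
  rw [hs', h0, dist_self] at hs
  linarith

/-! ## The lattice event sits inside the class event -/

/-- The whole polyline passes vertex `i` at time `dyadicTime i`. [folklore] -/
theorem latticeCurve_dyadicTime {Ω : Set ℂ} {δ : ℝ} {u v : Site 2} (γ : DomainSAW Ω δ u v) {i : ℕ}
    (hi : i ≤ γ.length) : latticeCurve γ (dyadicTime i) = meshPoint δ (γ.walk.getVert i) := by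
  rw [← dyadic_zero, ← suffixCurve_apply γ hi 0]
  change (γ.walk.drop i).toCurve (meshPoint δ) 0 = _
  rw [SimpleGraph.Walk.toCurve_apply_zero]

/-- A root return of the walk is a return of its class. [folklore] -/
theorem curve_mem_of_rootReturns {Ω : Set ℂ} {δ : ℝ} {u v : Site 2} {γ : DomainSAW Ω δ u v} {c : ℂ}
    {ρ₀ r : ℝ} (h : RootReturns γ c ρ₀ r) : γ.curve ∈ CurveClass.mk '' returnCurves c r ρ₀ := by
  obtain ⟨i, j, hij, hj, hri, hρj⟩ := h
  refine ⟨latticeCurve γ, ⟨dyadicTime i, dyadicTime j, dyadicTime_mono hij.le, ?_, ?_⟩, rfl⟩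
  · rwa [latticeCurve_dyadicTime γ (hij.le.trans hj)]
  · rwa [latticeCurve_dyadicTime γ hj]

/-! ## The pinning theorems -/

/-- **`RootReturn` from any necessity principle for closed antitone thickenings** (the common shape of
the two landed principles). [folklore] -/
theorem rootReturn_of_principle
    (H : ∀ (D : DobrushinDomain) (a b : ℝ → Site 2), IsEndpointApprox D a b →
      ∀ {F : ℕ → Set (CurveClass ℂ)}, (∀ n, IsClosed (F n)) → Antitone F →
        (∀ c : CurveClass ℂ, (∀ n, c ∈ F n) → ¬ Carrier D c) → ∀ {θ : ℝ≥0∞}, 0 < θ →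
          ∃ n, limsup (fun δ => law D.carrier δ (a δ) (b δ) {γ | γ.curve ∈ F n}) (𝓝[>] (0 : ℝ)) ≤ θ) :
    RootReturn := by
  intro D a b hab r θ hr hθ
  set F : ℕ → Set (CurveClass ℂ) := fun n => CurveClass.mk '' returnCurves (D.pt 0) r (r / ((n : ℝ) + 2))
    with hF
  have hFc : ∀ n, IsClosed (F n) := fun n => isClosed_image_returnCurves _ _ _
  have hanti : Antitone F := by
    intro m n hmn
    refine image_mono (returnCurves_mono _ _ ?_)
    exact div_le_div_of_nonneg_left hr.le (by positivity) (by simpa using hmn)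
  have hθ' : (0 : ℝ≥0∞) < ENNReal.ofReal θ / 2 :=
    ENNReal.half_pos (ENNReal.ofReal_pos.2 hθ).ne'
  obtain ⟨n, hn⟩ := H D a b hab hFc hanti (not_carrier_of_forall_mem D hr) hθ'
  refine ⟨r / ((n : ℝ) + 2), by positivity, ?_, ?_⟩
  · rw [div_lt_iff₀ (by positivity)]; nlinarith
  · have hle : limsup (fun δ => law D.carrier δ (a δ) (b δ)
        {γ | RootReturns γ (D.pt 0) (r / ((n : ℝ) + 2)) r}) (𝓝[>] (0 : ℝ)) ≤ ENNReal.ofReal θ / 2 := by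
      refine le_trans (Filter.limsup_le_limsup (Eventually.of_forall fun δ => ?_)) hn
      exact measure_mono fun γ hγ => curve_mem_of_rootReturns hγ
    have hlt : limsup (fun δ => law D.carrier δ (a δ) (b δ)
        {γ | RootReturns γ (D.pt 0) (r / ((n : ℝ) + 2)) r}) (𝓝[>] (0 : ℝ)) < ENNReal.ofReal θ :=
      hle.trans_lt (ENNReal.half_lt_self (ENNReal.ofReal_pos.2 hθ).ne' ENNReal.ofReal_ne_top)
    filter_upwards [Filter.eventually_lt_of_limsup_lt hlt] with δ hδ using hδ.le

/-- **`RootReturn` is implied by the summit conjecture** `SAWScalingLimit` (so the line's root-side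
input is not over-strong in truth value). [folklore] -/
theorem rootReturn_of_sawScalingLimit (h : _root_.SAWScalingLimit) : RootReturn :=
  rootReturn_of_principle fun _ _ _ hab _ hF hanti hcore _ hθ =>
    exists_limsup_law_le_of_sawScalingLimit h hab hF hanti hcore hθ

/-- **Registered anchor `stub_rootReturnPinned`** of this support file: `RootReturn` is implied by
the summit conjecture. [folklore] -/
theorem stub_rootReturnPinned : _root_.SAWScalingLimit → RootReturn :=
  rootReturn_of_sawScalingLimit

/-- **`RootReturn` is NECESSARY for the crux given `EventualTight`** (so the line wastes no strength on
the root side). [folklore] -/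
theorem rootReturn_of_crux (hT : EventualTight) (hS : SimpleSubseqLimits) : RootReturn :=
  rootReturn_of_principle fun _ _ _ hab _ hF hanti hcore _ hθ =>
    exists_limsup_law_le_of_crux hT hS hab hF hanti hcore hθ

/-! ## The G-type input is weaker than the sibling input `ShadowDecay` -/

/-- The event "some representative `ε`-nearly `(η, ρ)`-shadows its own past" (verbatim the
skeleton's `nearShadowEvent`). [folklore] -/
def nearShadowEvent (η ρ ε : ℝ) : Set (CurveClass ℂ) :=
  {c | ∃ γ : Curve ℂ, CurveClass.mk γ = c ∧ NearShadows γ η ρ ε}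

/-- **Discrete shadow decay at `(D; a_δ, b_δ)`** (verbatim the skeleton's `ShadowDecayAt`). [folklore] -/
def ShadowDecayAt (D : DobrushinDomain) (a b : ℝ → Site 2) : Prop :=
  ∀ η ρ θ : ℝ, 0 < η → 0 < ρ → 0 < θ → ∃ ε : ℝ, 0 < ε ∧
    ∀ᶠ δ in 𝓝[>] (0 : ℝ),
      law D.carrier δ (a δ) (b δ) {γ | γ.curve ∈ nearShadowEvent η ρ ε} ≤ ENNReal.ofReal θ

/-- Shadow decay along every endpoint approximation (verbatim the skeleton's `ShadowDecay`; the
sibling line's lattice input — deliberately untagged). -/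
def ShadowDecay : Prop :=
  ∀ (D : DobrushinDomain) (a b : ℝ → Site 2), IsEndpointApprox D a b → ShadowDecayAt D a b

/-- **Forward transport along the tail clock**: a near-shadowing of the REMAINING polyline after
`k ≤ |γ|` steps is a near-shadowing of the whole polyline (same thresholds). [folklore] -/
theorem nearShadows_latticeCurve_of_suffix {Ω : Set ℂ} {δ : ℝ} {u v : Site 2}
    (γ : DomainSAW Ω δ u v) {k : ℕ} (hk : k ≤ γ.length) {η ρ ε : ℝ}
    (h : NearShadows (suffixCurve γ k) η ρ ε) : NearShadows (latticeCurve γ) η ρ ε := by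
  obtain ⟨s₀, t, t', hs₀t, htt', hdisp, hall⟩ := h
  have hsm := dyadic_strictMono k
  have hval : ∀ τ : I, suffixCurve γ k τ = latticeCurve γ ⟨_, dyadic_mem k τ⟩ :=
    fun τ => suffixCurve_apply γ hk τ
  refine ⟨⟨_, dyadic_mem k s₀⟩, ⟨_, dyadic_mem k t⟩, ⟨_, dyadic_mem k t'⟩, hsm.monotone hs₀t,
    hsm.monotone htt', by rw [← hval, ← hval]; exact hdisp, fun u' hu hu' => ?_⟩
  obtain ⟨τ, rfl⟩ := exists_dyadic_eq ((dyadicTime_le_dyadic k t).trans hu)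
  obtain ⟨w, hw, hρ, hd⟩ := hall τ (hsm.le_iff_le.1 hu) (hsm.le_iff_le.1 hu')
  refine ⟨⟨_, dyadic_mem k w⟩, hsm.monotone hw, ?_, ?_⟩
  · rw [← hval, ← hval]; exact hρ
  · rw [← hval, ← hval]; exact hd

/-- **`SlitShadowDecay` is implied by the sibling input `ShadowDecay`** (line `marked-point-revisit`
v2 / the planner's `ShadowDecay`): its event is a sub-event of the whole-polyline near-shadowing
event, whose class form is `ShadowDecayAt`'s. Hence `SlitShadowDecay` is summit-implied and
crux+`EventualTight`-necessary whenever `ShadowDecay` is. [folklore] -/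
theorem slitShadowDecay_of_shadowDecay (h : ShadowDecay) : SlitShadowDecay := by
  intro D a b hab η ρ θ ρ₀ r₀ hη hρ hθ _ _ _
  obtain ⟨ε, hε, hev⟩ := h D a b hab η ρ θ hη hρ hθ
  refine ⟨ε, hε, ?_⟩
  filter_upwards [hev] with δ hδ
  refine le_trans (measure_mono ?_) hδ
  rintro γ ⟨k, hLEA, hns⟩
  exact ⟨latticeCurve γ, rfl, nearShadows_latticeCurve_of_suffix γ hLEA.1 hns⟩

/-! ## Both lattice inputs of the line are pinned from both sides -/

/-- **`SlitShadowDecay` is implied by the summit conjecture** (via `ShadowDecay`, pinned in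
`…PSShadowDecayPinned.lean`; the two copies of `ShadowDecay` agree by `rfl`). [folklore] -/
theorem slitShadowDecay_of_sawScalingLimit (h : _root_.SAWScalingLimit) : SlitShadowDecay :=
  slitShadowDecay_of_shadowDecay fun D a b hab =>
    ShadowDecayPinned.shadowDecay_of_sawScalingLimit h D a b hab

/-- **`SlitShadowDecay` is NECESSARY for the crux given `EventualTight`.** [folklore] -/
theorem slitShadowDecay_of_crux (hT : EventualTight) (hS : SimpleSubseqLimits) : SlitShadowDecay :=
  slitShadowDecay_of_shadowDecay fun D a b hab => ShadowDecayPinned.shadowDecay_of_crux hT hS D a b hab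

/-- **The line wastes nothing upward**: both lattice inputs follow from the summit conjecture
`SAWScalingLimit`. [folklore] -/
theorem inputs_of_sawScalingLimit (h : _root_.SAWScalingLimit) : RootReturn ∧ SlitShadowDecay :=
  ⟨rootReturn_of_sawScalingLimit h, slitShadowDecay_of_sawScalingLimit h⟩

/-- **The line wastes nothing downward**: both lattice inputs are necessary for the crux given
`EventualTight` — so, with the kernel-checked composition `SimpleSubseqLimits_of` of the skeleton
(inputs + A-side ⇒ crux), the pair (`RootReturn`, `SlitShadowDecay`) is EQUIVALENT to the crux modulo
`EventualTight` and the route's A-side items. [folklore] -/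
theorem inputs_of_crux (hT : EventualTight) (hS : SimpleSubseqLimits) : RootReturn ∧ SlitShadowDecay :=
  ⟨rootReturn_of_crux hT hS, slitShadowDecay_of_crux hT hS⟩

end Summit.CriticalPhenomena.SAWScalingLimit.Theorems.SimpleSubseqLimits.PastShadowing.RootReturnPinned

end
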